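import Summits.MatrixMultiplication.MatrixMultiplication.Theorems.ObstructionDescentCoreWindow
import Summits.MatrixMultiplication.MatrixMultiplication.Theorems.ObstructionDescentUnitOrbitPrime

set_option linter.dupNamespace false
set_option autoImplicit false

/-!
# Occurrence obstructions are born at irreducible window types (decomp-mm · lens 3 · gen 27)

Route `route-MatrixMultiplication-ObstructionDescent` (`ω(ℂ) = 2`), crux `P_O = NoOccurrenceObstruction`
(item `stmt-MatrixMultiplication-29040`), its line by name `noOccurrenceObstruction_of_core : UnitSaturationCore ⟹ P_O`
(`ObstructionDescentCoreWindow`).  `UnitSaturationCore` asks, cell by cell (`2 < τ < 4`, `n ≥ n₀(τ)`, `n² ≤ m`, `n^τ ≤ m`) and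
for every type/degree `(Λ, d)` in the CORE WINDOW (`d > m`, `ℓ_s(Λ) ≤ n²`, `ℓ_s ℓ_{s'} > m`), that `HWV_{Λ,d} ≤ I(σ_m) ⟹ HWV_{Λ,d} = ⊥`
(`σ_m = closure(GL_m³·⟨m⟩)`).

**§1 The reduction (kernel).**  Call `(Λ, d)` REDUCIBLE if `Λ = Λ₁ + Λ₂`, `d = d₁ + d₂` with both `HWV_{Λ_i,d_i} ≠ ⊥` and
`d₁, d₂ ≠ 0`, IRREDUCIBLE otherwise (an irreducible element of the semigroup of live types `{(Λ,d) : HWV_{Λ,d} ≠ ⊥}` — for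
partition-shaped types with at most `L` parts this is the Kronecker semigroup `KS_L = {(λ,μ,ν) : g(λ,μ,ν) > 0}`).
`unitSaturation_of_irreducible`: the saturation clause restricted to IRREDUCIBLE window types implies the full clause
`UnitSaturation` (all types with `≤ n²` parts per slot, all `τ > 2`), hence (`noOccurrenceObstruction_of_irreducible`) `P_O`;
and `unitSaturationCore_iff_irreducible` records that the restriction loses nothing.  Proof: strong induction on `d` inside a
cell — a reducible window type with `HWV ≤ I(σ_m)` has live summands of smaller degree and no more parts, which by induction do
not lie in `I(σ_m)`, contradicting the semigroup engine `not_hwvSpace_add_le_orbitVanishing_unitTensor` (`I(σ_m)` is prime,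
BI11 Lemma 3.2); off the window the landed engines 1–2 and the `τ ≥ 4` rung apply verbatim (`unitSaturation_of_core`).
Reading: in every cell a non-saturating window type OF MINIMAL DEGREE is irreducible — occurrence obstructions against
`ω = 2`, in saturation form, are born at semigroup-irreducible types of super-linear degree.

**§2 The slot-sum law (kernel).**  `sum_eq_degree_of_mem_hwvSpace`: a non-zero weight vector of type `Λ` and degree `d`
has `∑_a Λ s a = d` in EACH slot (scalar action `2·1 ∈ B_m` in one slot versus homogeneity — a one-line shadow of the
monomial weight law `wt_eq_of_mem_support` of `ObstructionDescentCoordinateDegree`, proved here directly); corollaries: a live type of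
degree `0` is `0` (`eq_zero_of_hwvSpace_zero_ne_bot`, so "irreducible" may equivalently be read with `Λ_i = 0`), and
`degree_le_card_mul_sup`: `d ≤ ℓ_s(Λ) · max_a Λ s a` — a live window type (`d > m ≥ n^τ`, `ℓ_s ≤ n²`) has an exponent
`> m/n² ≥ n^{τ-2}` in every slot, i.e. lies far outside any Kronecker-stable range.

Census (informal companion, memo `NODE-g27.md` of the cell; plain Python, Murnaghan–Nakayama): irreducible classes of `KS_L`
per degree `d = 1,2,…` — `L = 2`: one class in each degree `1,2,3,4` (`(1)³`, `((2),(1,1),(1,1))`, `((2,1))³`, `((2,2))³`),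
none in degrees `5…14`;
`L = 3`: `1,1,3,5,7,10,9,9,14,7,4,12,2,3,6,2` (`d ≤ 16`, not exhausted); `L = 4`: `1,1,3,8,16,40,56,100,102,162,94,264,90`
(`d ≤ 13`), among them `((3⁴),(3⁴),(3⁴))` (`g = 1`, the degree-12 fundamental invariant) and `((3⁴),(4³),(4³))` (`g = 1`).
So for the cell `n = 2` (types with `≤ 4` parts) the irreducible window is populated in every degree `6 ≤ d ≤ 13` for
`m ≤ 8`, and first in degree `12`/`13` for `m = 9…11`/`m = 12`; the naive hope "`KS_{n²}` is generated in degree `≤ m`"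
(which would make `UnitSaturationCore` a theorem) is FALSE throughout `τ < 4`.  Nothing here proves `ω = 2`; no definition is
introduced; sorry-free; axioms `propext`, `Classical.choice`, `Quot.sound`.
[cite: BurgisserIkenmeyer2011, Lemma 3.2, §7; BurgisserIkenmeyer2017, §5]
-/

noncomputable section

open scoped BigOperators

namespace Summit.MatrixMultiplication.MatrixMultiplication.Theorems.ObstructionDescentIrreducibleTypes

open Literature.Computability.AlgebraicComplexity (tensorRank matMulTensor unitTensor actTensor)
open Summit.MatrixMultiplication.MatrixMultiplication.Theorems.ObstructionCalculus
open Summit.MatrixMultiplication.MatrixMultiplication.Theses.ObstructionDescent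
open Summit.MatrixMultiplication.MatrixMultiplication.Theorems.ObstructionDescentInformationAxis
open Summit.MatrixMultiplication.MatrixMultiplication.Theorems.ObstructionDescentCoreWindow

variable {m : ℕ}

/-! ### §1 · Reduction of `UnitSaturationCore` to irreducible window types -/

/-- A summand has at most the parts of the sum (left summand). [bookkeeping] -/
theorem card_filter_le_of_add_left (Λ₁ Λ₂ : Fin 3 → Fin m → ℕ) (s : Fin 3) :
    (Finset.univ.filter fun a => Λ₁ s a ≠ 0).card ≤ (Finset.univ.filter fun a => (Λ₁ + Λ₂) s a ≠ 0).card := by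
  refine Finset.card_le_card fun a ha => ?_
  simp only [Finset.mem_filter, Finset.mem_univ, true_and, Pi.add_apply] at ha ⊢
  omega

/-- A summand has at most the parts of the sum (right summand). [bookkeeping] -/
theorem card_filter_le_of_add_right (Λ₁ Λ₂ : Fin 3 → Fin m → ℕ) (s : Fin 3) :
    (Finset.univ.filter fun a => Λ₂ s a ≠ 0).card ≤ (Finset.univ.filter fun a => (Λ₁ + Λ₂) s a ≠ 0).card := by
  refine Finset.card_le_card fun a ha => ?_
  simp only [Finset.mem_filter, Finset.mem_univ, true_and, Pi.add_apply] at ha ⊢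
  omega

/-- **Reduction to irreducible types (kernel).**  If in every cell of the core window every IRREDUCIBLE type (no splitting
`Λ = Λ₁ + Λ₂`, `d = d₁ + d₂` into live types of positive degrees) satisfies the saturation clause `HWV_{Λ,d} ≤ I(σ_m) ⟹
HWV_{Λ,d} = ⊥`, then the clause holds for ALL types with at most `n²` parts per slot and all `τ > 2` (`UnitSaturation`).
Strong induction on the degree inside the cell, the semigroup engine closing the reducible case. [this node] -/
theorem unitSaturation_of_irreducible
    (hirr : ∀ τ : ℝ, 2 < τ → τ < 4 → ∃ n₀ : ℕ, ∀ n m : ℕ, n₀ ≤ n → n * n ≤ m → (n : ℝ) ^ τ ≤ (m : ℝ) →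
      ∀ (Λ : Fin 3 → Fin m → ℕ) (d : ℕ), m < d → (∀ s, (Finset.univ.filter fun a => Λ s a ≠ 0).card ≤ n * n) →
        m < (Finset.univ.filter fun a => Λ 0 a ≠ 0).card * (Finset.univ.filter fun a => Λ 1 a ≠ 0).card →
        m < (Finset.univ.filter fun a => Λ 0 a ≠ 0).card * (Finset.univ.filter fun a => Λ 2 a ≠ 0).card →
        m < (Finset.univ.filter fun a => Λ 1 a ≠ 0).card * (Finset.univ.filter fun a => Λ 2 a ≠ 0).card →
        (∀ (Λ₁ Λ₂ : Fin 3 → Fin m → ℕ) (d₁ d₂ : ℕ), Λ₁ + Λ₂ = Λ → d₁ + d₂ = d →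
            hwvSpace Λ₁ d₁ ≠ ⊥ → hwvSpace Λ₂ d₂ ≠ ⊥ → d₁ = 0 ∨ d₂ = 0) →
          hwvSpace Λ d ≤ orbitVanishing (unitTensor ℂ m) → hwvSpace Λ d = ⊥) :
    ∀ τ : ℝ, 2 < τ → ∃ n₀ : ℕ, ∀ n m : ℕ, n₀ ≤ n → n * n ≤ m → (n : ℝ) ^ τ ≤ (m : ℝ) →
      ∀ (Λ : Fin 3 → Fin m → ℕ) (d : ℕ), (∀ s, (Finset.univ.filter fun a => Λ s a ≠ 0).card ≤ n * n) →
        hwvSpace Λ d ≤ orbitVanishing (unitTensor ℂ m) → hwvSpace Λ d = ⊥ := by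
  intro τ hτ
  by_cases h4 : 4 ≤ τ
  · exact ⟨0, fun n m _ _ hτm Λ d hp hU => unitSaturation_of_four_le h4 hτm Λ d (hp 0) (hp 1) hU⟩
  · obtain ⟨n₀, hn₀⟩ := hirr τ hτ (lt_of_not_ge h4)
    refine ⟨n₀, fun n m hn hnm hτm => ?_⟩
    intro Λ d
    induction d using Nat.strong_induction_on generalizing Λ with
    | _ d ih => ?_
    intro hparts hU
    by_cases hd : d ≤ m
    · exact hwvSpace_eq_bot_of_degree_le hd hU
    by_cases h01 : (Finset.univ.filter fun a => Λ 0 a ≠ 0).card * (Finset.univ.filter fun a => Λ 1 a ≠ 0).card ≤ m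
    · exact hwvSpace_eq_bot_of_card_mul_card_le h01 hU
    by_cases h02 : (Finset.univ.filter fun a => Λ 0 a ≠ 0).card * (Finset.univ.filter fun a => Λ 2 a ≠ 0).card ≤ m
    · exact hwvSpace_eq_bot_of_card_mul_card_le₀₂ h02 hU
    by_cases h12 : (Finset.univ.filter fun a => Λ 1 a ≠ 0).card * (Finset.univ.filter fun a => Λ 2 a ≠ 0).card ≤ m
    · exact hwvSpace_eq_bot_of_card_mul_card_le₁₂ h12 hU
    by_cases hred : ∃ (Λ₁ Λ₂ : Fin 3 → Fin m → ℕ) (d₁ d₂ : ℕ), Λ₁ + Λ₂ = Λ ∧ d₁ + d₂ = d ∧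
        hwvSpace Λ₁ d₁ ≠ ⊥ ∧ hwvSpace Λ₂ d₂ ≠ ⊥ ∧ d₁ ≠ 0 ∧ d₂ ≠ 0
    · -- reducible: both live summands have smaller degree and no more parts, so by induction neither lies in `I(σ_m)`;
      -- the semigroup engine then forbids `HWV_{Λ,d} ≤ I(σ_m)`.
      obtain ⟨Λ₁, Λ₂, d₁, d₂, hΛ, hdd, hne₁, hne₂, hd₁, hd₂⟩ := hred
      subst hΛ
      subst hdd
      have h₁ : ¬ hwvSpace Λ₁ d₁ ≤ orbitVanishing (unitTensor ℂ m) := fun hle =>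
        hne₁ (ih d₁ (by omega) Λ₁ (fun s => (card_filter_le_of_add_left Λ₁ Λ₂ s).trans (hparts s)) hle)
      have h₂ : ¬ hwvSpace Λ₂ d₂ ≤ orbitVanishing (unitTensor ℂ m) := fun hle =>
        hne₂ (ih d₂ (by omega) Λ₂ (fun s => (card_filter_le_of_add_right Λ₁ Λ₂ s).trans (hparts s)) hle)
      exact absurd hU (not_hwvSpace_add_le_orbitVanishing_unitTensor h₁ h₂)
    · -- irreducible: the hypothesis applies
      exact hn₀ n m hn hnm hτm Λ d (lt_of_not_ge hd) hparts (lt_of_not_ge h01) (lt_of_not_ge h02)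
        (lt_of_not_ge h12)
        (fun Λ₁ Λ₂ d₁ d₂ hΛ hdd hne₁ hne₂ => by
          by_contra hcon
          obtain ⟨hd₁, hd₂⟩ := not_or.mp hcon
          exact hred ⟨Λ₁, Λ₂, d₁, d₂, hΛ, hdd, hne₁, hne₂, hd₁, hd₂⟩)
        hU

/-- The trivial direction: `UnitSaturation` implies its restriction to irreducible core-window types. [bookkeeping] -/
theorem irreducibleCore_of_unitSaturation
    (h₁ : ∀ τ : ℝ, 2 < τ → ∃ n₀ : ℕ, ∀ n m : ℕ, n₀ ≤ n → n * n ≤ m → (n : ℝ) ^ τ ≤ (m : ℝ) →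
      ∀ (Λ : Fin 3 → Fin m → ℕ) (d : ℕ), (∀ s, (Finset.univ.filter fun a => Λ s a ≠ 0).card ≤ n * n) →
        hwvSpace Λ d ≤ orbitVanishing (unitTensor ℂ m) → hwvSpace Λ d = ⊥) :
    ∀ τ : ℝ, 2 < τ → τ < 4 → ∃ n₀ : ℕ, ∀ n m : ℕ, n₀ ≤ n → n * n ≤ m → (n : ℝ) ^ τ ≤ (m : ℝ) →
      ∀ (Λ : Fin 3 → Fin m → ℕ) (d : ℕ), m < d → (∀ s, (Finset.univ.filter fun a => Λ s a ≠ 0).card ≤ n * n) →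
        m < (Finset.univ.filter fun a => Λ 0 a ≠ 0).card * (Finset.univ.filter fun a => Λ 1 a ≠ 0).card →
        m < (Finset.univ.filter fun a => Λ 0 a ≠ 0).card * (Finset.univ.filter fun a => Λ 2 a ≠ 0).card →
        m < (Finset.univ.filter fun a => Λ 1 a ≠ 0).card * (Finset.univ.filter fun a => Λ 2 a ≠ 0).card →
        (∀ (Λ₁ Λ₂ : Fin 3 → Fin m → ℕ) (d₁ d₂ : ℕ), Λ₁ + Λ₂ = Λ → d₁ + d₂ = d →
            hwvSpace Λ₁ d₁ ≠ ⊥ → hwvSpace Λ₂ d₂ ≠ ⊥ → d₁ = 0 ∨ d₂ = 0) →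
          hwvSpace Λ d ≤ orbitVanishing (unitTensor ℂ m) → hwvSpace Λ d = ⊥ := by
  intro τ hτ _
  obtain ⟨n₀, hn₀⟩ := h₁ τ hτ
  exact ⟨n₀, fun n m hn hnm hτm Λ d _ hparts _ _ _ _ hU => hn₀ n m hn hnm hτm Λ d hparts hU⟩

/-- **`UnitSaturationCore ⟺ UnitSaturationCore|irreducible`**: the open stub of the line of crux 29040 is equivalent to its
restriction to irreducible window types (both are equivalent to `UnitSaturation`, `unitSaturation_of_core`). [this node] -/
theorem unitSaturationCore_iff_irreducible :
    (∀ τ : ℝ, 2 < τ → τ < 4 → ∃ n₀ : ℕ, ∀ n m : ℕ, n₀ ≤ n → n * n ≤ m → (n : ℝ) ^ τ ≤ (m : ℝ) →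
      ∀ (Λ : Fin 3 → Fin m → ℕ) (d : ℕ), m < d → (∀ s, (Finset.univ.filter fun a => Λ s a ≠ 0).card ≤ n * n) →
        m < (Finset.univ.filter fun a => Λ 0 a ≠ 0).card * (Finset.univ.filter fun a => Λ 1 a ≠ 0).card →
        m < (Finset.univ.filter fun a => Λ 0 a ≠ 0).card * (Finset.univ.filter fun a => Λ 2 a ≠ 0).card →
        m < (Finset.univ.filter fun a => Λ 1 a ≠ 0).card * (Finset.univ.filter fun a => Λ 2 a ≠ 0).card →
          hwvSpace Λ d ≤ orbitVanishing (unitTensor ℂ m) → hwvSpace Λ d = ⊥) ↔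
    (∀ τ : ℝ, 2 < τ → τ < 4 → ∃ n₀ : ℕ, ∀ n m : ℕ, n₀ ≤ n → n * n ≤ m → (n : ℝ) ^ τ ≤ (m : ℝ) →
      ∀ (Λ : Fin 3 → Fin m → ℕ) (d : ℕ), m < d → (∀ s, (Finset.univ.filter fun a => Λ s a ≠ 0).card ≤ n * n) →
        m < (Finset.univ.filter fun a => Λ 0 a ≠ 0).card * (Finset.univ.filter fun a => Λ 1 a ≠ 0).card →
        m < (Finset.univ.filter fun a => Λ 0 a ≠ 0).card * (Finset.univ.filter fun a => Λ 2 a ≠ 0).card →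
        m < (Finset.univ.filter fun a => Λ 1 a ≠ 0).card * (Finset.univ.filter fun a => Λ 2 a ≠ 0).card →
        (∀ (Λ₁ Λ₂ : Fin 3 → Fin m → ℕ) (d₁ d₂ : ℕ), Λ₁ + Λ₂ = Λ → d₁ + d₂ = d →
            hwvSpace Λ₁ d₁ ≠ ⊥ → hwvSpace Λ₂ d₂ ≠ ⊥ → d₁ = 0 ∨ d₂ = 0) →
          hwvSpace Λ d ≤ orbitVanishing (unitTensor ℂ m) → hwvSpace Λ d = ⊥) :=
  ⟨fun hcore => irreducibleCore_of_unitSaturation (unitSaturation_of_core hcore),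
    fun hirr τ hτ _ => by
      obtain ⟨n₀, hn₀⟩ := unitSaturation_of_irreducible hirr τ hτ
      exact ⟨n₀, fun n m hn hnm hτm Λ d _ hparts _ _ _ hU => hn₀ n m hn hnm hτm Λ d hparts hU⟩⟩

/-- **The line of crux 29040 through irreducible types**: the saturation clause on IRREDUCIBLE core-window types implies
`NoOccurrenceObstruction` (by name, via `noOccurrenceObstruction_of_unitSaturation`). [this node] -/
theorem noOccurrenceObstruction_of_irreducible
    (hirr : ∀ τ : ℝ, 2 < τ → τ < 4 → ∃ n₀ : ℕ, ∀ n m : ℕ, n₀ ≤ n → n * n ≤ m → (n : ℝ) ^ τ ≤ (m : ℝ) →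
      ∀ (Λ : Fin 3 → Fin m → ℕ) (d : ℕ), m < d → (∀ s, (Finset.univ.filter fun a => Λ s a ≠ 0).card ≤ n * n) →
        m < (Finset.univ.filter fun a => Λ 0 a ≠ 0).card * (Finset.univ.filter fun a => Λ 1 a ≠ 0).card →
        m < (Finset.univ.filter fun a => Λ 0 a ≠ 0).card * (Finset.univ.filter fun a => Λ 2 a ≠ 0).card →
        m < (Finset.univ.filter fun a => Λ 1 a ≠ 0).card * (Finset.univ.filter fun a => Λ 2 a ≠ 0).card →
        (∀ (Λ₁ Λ₂ : Fin 3 → Fin m → ℕ) (d₁ d₂ : ℕ), Λ₁ + Λ₂ = Λ → d₁ + d₂ = d →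
            hwvSpace Λ₁ d₁ ≠ ⊥ → hwvSpace Λ₂ d₂ ≠ ⊥ → d₁ = 0 ∨ d₂ = 0) →
          hwvSpace Λ d ≤ orbitVanishing (unitTensor ℂ m) → hwvSpace Λ d = ⊥) :
    NoOccurrenceObstruction :=
  noOccurrenceObstruction_of_unitSaturation (unitSaturation_of_irreducible hirr)

/-- **Minimal obstruction types are irreducible** (the reading of §1 inside one cell, any `m`): if a type `Λ` with live
summands `Λ₁, Λ₂` of positive degrees lies in `I(σ_m)` in degree `d₁ + d₂`, then one of the summands already lies in `I(σ_m)`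
— so a non-saturating (resp. non-occurring) type of minimal degree is never such a sum. [this node] -/
theorem summand_le_orbitVanishing_of_add_le {Λ₁ Λ₂ : Fin 3 → Fin m → ℕ} {d₁ d₂ : ℕ}
    (h : hwvSpace (Λ₁ + Λ₂) (d₁ + d₂) ≤ orbitVanishing (unitTensor ℂ m)) :
    hwvSpace Λ₁ d₁ ≤ orbitVanishing (unitTensor ℂ m) ∨ hwvSpace Λ₂ d₂ ≤ orbitVanishing (unitTensor ℂ m) := by
  by_contra hcon
  obtain ⟨h₁, h₂⟩ := not_or.mp hcon
  exact not_hwvSpace_add_le_orbitVanishing_unitTensor h₁ h₂ h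

/-! ### §2 · The slot-sum law: live types have slot sums equal to the degree -/

/-- A form of degree `d` scales by `c^d` under dilation of the argument. [folklore] -/
theorem eval_smul_of_isHomogeneous {σ : Type*} [Fintype σ] (f : MvPolynomial σ ℂ) {d : ℕ}
    (hf : f.IsHomogeneous d) (c : ℂ) (x : σ → ℂ) :
    MvPolynomial.eval (c • x) f = c ^ d * MvPolynomial.eval x f := by
  rw [MvPolynomial.eval_eq', MvPolynomial.eval_eq', Finset.mul_sum]
  refine Finset.sum_congr rfl fun α hα => ?_
  have hdeg : ∑ i, α i = d := by
    rw [← Finsupp.degree_eq_sum, Finsupp.degree_apply]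
    exact (hf.degree_eq_sum_deg_support hα).symm
  simp_rw [Pi.smul_apply, smul_eq_mul, mul_pow, Finset.prod_mul_distrib, Finset.prod_pow_eq_pow_sum, hdeg]
  ring

/-- `evalT` is evaluation at the entry function. [bookkeeping] -/
theorem evalT_eq_eval (u : Tensor ℂ m) (f : MvPolynomial (Idx m) ℂ) :
    evalT u f = MvPolynomial.eval (fun p : Idx m => u p.1 p.2.1 p.2.2) f :=
  (eval_eq_evalT (fun p : Idx m => u p.1 p.2.1 p.2.2) f).symm

/-- Weight vectors of degree `d` scale by `c^d` under dilation of the tensor. [folklore] -/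
theorem evalT_dilate_of_mem_hwvSpace {Λ : Fin 3 → Fin m → ℕ} {d : ℕ} {f : MvPolynomial (Idx m) ℂ}
    (hf : f ∈ hwvSpace Λ d) (c : ℂ) (t : Tensor ℂ m) :
    evalT (fun a b e => c * t a b e) f = c ^ d * evalT t f := by
  rw [evalT_eq_eval, evalT_eq_eval t]
  exact eval_smul_of_isHomogeneous f hf.1 c _

/-- **Slot-sum law (kernel).**  A non-zero weight vector of type `Λ` in degree `d` has `∑_a Λ s a = d` in every slot `s`:
the scalar matrix `2·1 ∈ B_m` acting in slot `s` multiplies the value by the character `2^{|Λ s|}` and, by homogeneity, by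
`2^d`. [cite: BurgisserIkenmeyer2011, §3.1–3.2] -/
theorem sum_eq_degree_of_mem_hwvSpace {Λ : Fin 3 → Fin m → ℕ} {d : ℕ} {f : MvPolynomial (Idx m) ℂ}
    (hf : f ∈ hwvSpace Λ d) (hf0 : f ≠ 0) (s : Fin 3) : ∑ a, Λ s a = d := by
  classical
  obtain ⟨x, hx⟩ : ∃ x : Idx m → ℂ, MvPolynomial.eval x f ≠ 0 := by
    by_contra h
    exact hf0 (MvPolynomial.funext fun y => by rw [not_not.mp (not_exists.mp h y), map_zero])
  rw [eval_eq_evalT] at hx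
  have hδ : ∀ i : Fin m, (fun _ : Fin m => (2 : ℂ)) i ≠ 0 := fun _ => two_ne_zero
  have key := evalT_slotAct hf (diagonal_mem_borel hδ) (fun a b e => x (a, b, e)) s
  rw [slotAct_diagonal, weightChar_diagonal, Finset.prod_pow_eq_pow_sum] at key
  have key' : evalT (fun a b e => (2 : ℂ) * (fun a b e => x (a, b, e)) a b e) f =
      (2 : ℂ) ^ (∑ i, Λ s i) * evalT (fun a b e => x (a, b, e)) f := key
  rw [evalT_dilate_of_mem_hwvSpace hf] at key'
  have h2 : (2 : ℂ) ^ d = 2 ^ (∑ i, Λ s i) := mul_right_cancel₀ hx key'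
  have h3 : 2 ^ d = 2 ^ (∑ i, Λ s i) := by exact_mod_cast h2
  exact (Nat.pow_right_injective le_rfl h3).symm

/-- Slot-sum law for live types: `HWV_{Λ,d} ≠ ⊥ ⟹ ∑_a Λ s a = d` for every slot. [this node] -/
theorem sum_eq_degree_of_hwvSpace_ne_bot {Λ : Fin 3 → Fin m → ℕ} {d : ℕ} (h : hwvSpace Λ d ≠ ⊥) (s : Fin 3) :
    ∑ a, Λ s a = d := by
  obtain ⟨f, hf, hf0⟩ := (Submodule.ne_bot_iff _).1 h
  exact sum_eq_degree_of_mem_hwvSpace hf hf0 s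

/-- A live type of degree `0` is the zero type (so the two readings of "irreducible" — by degrees or by types — agree).
[this node] -/
theorem eq_zero_of_hwvSpace_zero_ne_bot {Λ : Fin 3 → Fin m → ℕ} (h : hwvSpace Λ 0 ≠ ⊥) : Λ = 0 := by
  funext s a
  have hs := sum_eq_degree_of_hwvSpace_ne_bot h s
  exact (Finset.sum_eq_zero_iff.1 hs) a (Finset.mem_univ a)

/-- The three slot sums of a live type agree. [this node] -/
theorem sum_eq_sum_of_hwvSpace_ne_bot {Λ : Fin 3 → Fin m → ℕ} {d : ℕ} (h : hwvSpace Λ d ≠ ⊥) (s s' : Fin 3) :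
    ∑ a, Λ s a = ∑ a, Λ s' a := by
  rw [sum_eq_degree_of_hwvSpace_ne_bot h s, sum_eq_degree_of_hwvSpace_ne_bot h s']

/-- **Large exponents in the window.**  A live type satisfies `d ≤ ℓ_s(Λ) · max_a Λ s a` in every slot; in the core window
(`d > m ≥ n^τ`, `ℓ_s(Λ) ≤ n²`) some exponent therefore exceeds `m / n² ≥ n^{τ-2}`. [this node] -/
theorem degree_le_card_mul_sup {Λ : Fin 3 → Fin m → ℕ} {d : ℕ} (h : hwvSpace Λ d ≠ ⊥) (s : Fin 3) :
    d ≤ (Finset.univ.filter fun a => Λ s a ≠ 0).card * Finset.univ.sup (Λ s) := by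
  classical
  have hsum : ∑ a ∈ Finset.univ.filter (fun a => Λ s a ≠ 0), Λ s a = d := by
    rw [Finset.sum_filter_ne_zero, sum_eq_degree_of_hwvSpace_ne_bot h s]
  rw [← hsum]
  have hle := Finset.sum_le_card_nsmul (Finset.univ.filter fun a => Λ s a ≠ 0) (Λ s) (Finset.univ.sup (Λ s))
    (fun a _ => Finset.le_sup (f := Λ s) (Finset.mem_univ a))
  simpa [smul_eq_mul] using hle

/-- Window reading of the large-exponent law: with at most `N` parts in slot `s` and degree `d > m`, the largest exponent
in slot `s` is `> m / N` (stated multiplicatively: `m < N · max`). [this node] -/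
theorem lt_card_mul_sup_of_window {Λ : Fin 3 → Fin m → ℕ} {d N : ℕ} (h : hwvSpace Λ d ≠ ⊥) (s : Fin 3)
    (hparts : (Finset.univ.filter fun a => Λ s a ≠ 0).card ≤ N) (hd : m < d) :
    m < N * Finset.univ.sup (Λ s) :=
  lt_of_lt_of_le hd ((degree_le_card_mul_sup h s).trans (Nat.mul_le_mul_right _ hparts))

end Summit.MatrixMultiplication.MatrixMultiplication.Theorems.ObstructionDescentIrreducibleTypes
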